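import Summits.Langlands.Langlands.Theses.ParityBlindBianchi
import Summits.Langlands.Langlands.Theorems.ParityBlindBianchiIcosahedralQuadraticDescentFields

/-!
# `ResidualBianchiDoorLevel` (E1′, stmt-Langlands-15112): the icosahedral hypotheses are load-bearing,
# and the field quantifier is not vacuous

Negative-side lemma (refuter cdisprove seat, 2026-08-16; supports stmt-Langlands-15112; does NOT refute
the crux).

`ParityBlindBianchi.ResidualBianchiDoorLevel` is `∀ ι ρ, hirr → hA5 → ∃ S₀ ∋ 2, ∀ K (totally complex,
quadratic, 2 split), ∃ σ (pinned entrywise to ρ|_K through ι) with finite image, irreducible,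
projective image ≅ A₅, ∃ π₀ regular algebraic cuspidal, congruence at every good place`.

* `residualBianchiDoorLevel_false_without_icosahedral` — with the two hypotheses on `ρ` (`hirr`,
  `hA5`) DROPPED the statement (stated inline) is FALSE: for the trivial representation `ρ = 1` and
  `K = ℚ(√-15)` the pinned model `σ` is trivial (`ι` is injective), so its projective image is the
  trivial group, not `≅ A₅` (`1 ≠ 60`).  Any proof of E1′ must use `hA5` — and, conversely, the
  witness certifies that the `∀ K` quantifier of E1′ is NOT vacuous: `ℚ(√-15)` (`sqrtNegField ℚ 15`)
  satisfies all three field hypotheses (`IcosahedralQuadraticDescent.isTotallyComplex_sqrtNegField`,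
  `finrank_sqrtNegField`, `exists_two_places_two_mem`).
* `nonempty_ringEquiv_padicAlgCl_complex` — `ℚ̄₂ ≃+* ℂ` exists (Steinitz), to instantiate `∀ ι`.
-/

noncomputable section

set_option linter.dupNamespace false

namespace Summit.Langlands.Langlands.Theorems.ResidualBianchiDoorLevel.Negative

open scoped MatrixGroups NumberField
open NumberField IsDedekindDomain Field
open Literature.NumberTheory.Automorphic Literature.NumberTheory.GaloisRepresentations
  Literature.NumberTheory.GaloisRepresentations.QuadraticFamily

/-- **`ℚ̄₂ ≃ ℂ` as abstract fields** (both algebraically closed of characteristic `0` and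
cardinality `𝔠`; Steinitz).  Same argument as in the route's deciding theorem `closes`. [folklore] -/
theorem nonempty_ringEquiv_padicAlgCl_complex : Nonempty (PadicAlgCl 2 ≃+* ℂ) := by
  have hQ2 : Cardinal.mk ℚ_[2] = Cardinal.continuum := by
    apply le_antisymm
    · change Cardinal.mk (Quotient (CauSeq.equiv : Setoid (CauSeq ℚ (padicNorm 2)))) ≤
        Cardinal.continuum
      refine (Cardinal.mk_quotient_le
        (s := (CauSeq.equiv : Setoid (CauSeq ℚ (padicNorm 2))))).trans ?_
      refine (Cardinal.mk_subtype_le _).trans_eq ?_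
      rw [← Cardinal.power_def, Cardinal.mk_nat, Cardinal.mkRat, Cardinal.aleph0_power_aleph0]
    · exact continuum_le_cardinal_of_nontriviallyNormedField ℚ_[2]
  have hC2 : Cardinal.mk (PadicAlgCl 2) = Cardinal.continuum := by
    apply le_antisymm
    · refine (Algebra.IsAlgebraic.cardinalMk_le_max ℚ_[2] (PadicAlgCl 2)).trans ?_
      rw [hQ2, max_eq_left Cardinal.aleph0_le_continuum]
    · rw [← hQ2]
      exact Cardinal.mk_le_of_injective (algebraMap ℚ_[2] (PadicAlgCl 2)).injective
  refine IsAlgClosed.ringEquiv_of_equiv_of_charZero ?_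
    (Cardinal.eq.1 (by rw [hC2, Cardinal.mk_complex]))
  rw [hC2]
  exact Cardinal.aleph0_lt_continuum

/-- A group isomorphic to `A₅` does not have exactly one element (`#A₅ = 60`). [folklore] -/
theorem card_ne_one_of_mulEquiv_alternatingGroup {P : Type*} [Group P]
    (e : P ≃* alternatingGroup (Fin 5)) : Nat.card P ≠ 1 := by
  rw [Nat.card_congr e.toEquiv, nat_card_alternatingGroup, Nat.card_eq_fintype_card,
    Fintype.card_fin]
  decide

/-- **`ResidualBianchiDoorLevel` is FALSE without its icosahedral hypotheses** (`_false_without_`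
lemma: any proof must use `hA5`).  The statement below is E1′ verbatim with
`ρ.toGaloisRep.IsIrreducible →` and `Nonempty (… ≃* alternatingGroup (Fin 5)) →` deleted.  Witness:
some `ι` (Steinitz), the trivial `ρ : Γ_ℚ → GL₂(ℂ)`, and `K = ℚ(√-15)` (totally complex, quadratic,
`2` split): the entrywise-pinned `σ` is then trivial, so `(PGL₂ ∘ σ)(Γ_K) = 1 ≇ A₅`. [folklore] -/
theorem residualBianchiDoorLevel_false_without_icosahedral :
    ¬ ∀ (ι : PadicAlgCl 2 ≃+* ℂ) (ρ : FramedGaloisRep ℚ ℂ 2),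
      ∃ S₀ : Finset ℕ, 2 ∈ S₀ ∧ ∀ (K : Type) [Field K] [NumberField K], IsTotallyComplex K →
        Module.finrank ℚ K = 2 →
        (∃ v w : HeightOneSpectrum (𝓞 K), v ≠ w ∧ ((2 : ℕ) : 𝓞 K) ∈ v.asIdeal ∧
          ((2 : ℕ) : 𝓞 K) ∈ w.asIdeal) →
        ∃ σ : FramedGaloisRep K (PadicAlgCl 2) 2,
          (∀ (g : absoluteGaloisGroup K) (i j : Fin 2),
            ι ((σ g).val i j) = ((FramedGaloisRep.restrictField K ρ) g).val i j) ∧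
          Finite σ.toMonoidHom.range ∧ σ.toGaloisRep.IsIrreducible ∧
          Nonempty ((Matrix.ProjGenLinGroup.mk.comp σ.toMonoidHom).range ≃*
            alternatingGroup (Fin 5)) ∧
          ∃ (hcpt : isCompact_glFiniteIntegralLevel 2 K)
            (π₀ : CuspidalAutomorphicRepData 2 K hcpt), π₀.1.IsRegularAlgebraic ∧
            ∀ v : HeightOneSpectrum (𝓞 K), (∀ ℓ ∈ S₀, ((ℓ : ℕ) : 𝓞 K) ∉ v.asIdeal) →
              ∃ (α : Multiset ℂ) (P : Polynomial (PadicAlgCl 2)), π₀.1.HasSatakeParamAt v α ∧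
                σ.IsUnramifiedAt v ∧ σ.HasFrobCharpolyAt v P ∧
                ∀ i : ℕ, ‖P.coeff i - (arithFrobPolyOfSatake ι v.residueCard 2 α).coeff i‖ < 1 := by
  intro h
  obtain ⟨ι⟩ := nonempty_ringEquiv_padicAlgCl_complex
  -- the trivial representation
  let ρ₀ : FramedGaloisRep ℚ ℂ 2 :=
    { (1 : absoluteGaloisGroup ℚ →* GL (Fin 2) ℂ) with continuous_toFun := continuous_const }
  have hρ₀ : ∀ g, ρ₀ g = 1 := fun _ => rfl
  obtain ⟨S₀, -, hK⟩ := h ι ρ₀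
  -- the admissible field `ℚ(√-15)`
  haveI : Fact (¬ IsSquare (-((15 : ℕ) : ℚ))) :=
    IcosahedralQuadraticDescent.fact_not_isSquare_neg_natCast (by norm_num)
  obtain ⟨σ, hmodel, -, -, ⟨e⟩, -⟩ := hK (sqrtNegField ℚ 15)
    (IcosahedralQuadraticDescent.isTotallyComplex_sqrtNegField (by norm_num)) finrank_sqrtNegField
    (IcosahedralQuadraticDescent.exists_two_places_two_mem (D := 15) (by norm_num))
  -- the pinned model is trivial
  have hσ : ∀ g : absoluteGaloisGroup (sqrtNegField ℚ 15), σ g = 1 := by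
    intro g
    refine Matrix.GeneralLinearGroup.ext fun i j => ι.injective ?_
    have h1 := hmodel g i j
    rw [FramedGaloisRep.restrictField_apply, hρ₀] at h1
    rw [h1, Units.val_one, Units.val_one, Matrix.one_apply, Matrix.one_apply]
    split_ifs <;> simp
  -- hence the projective image is trivial, not `≅ A₅`
  have hbot : (Matrix.ProjGenLinGroup.mk.comp σ.toMonoidHom).range = ⊥ := by
    rw [Subgroup.eq_bot_iff_forall]
    rintro _ ⟨g, rfl⟩
    rw [MonoidHom.comp_apply]
    change Matrix.ProjGenLinGroup.mk (σ g) = 1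
    rw [hσ g, map_one]
  apply card_ne_one_of_mulEquiv_alternatingGroup e
  rw [hbot]
  exact Subgroup.card_bot

end Summit.Langlands.Langlands.Theorems.ResidualBianchiDoorLevel.Negative

end
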